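import Summits.CriticalPhenomena.CardyFormulaZ2.Theorems.CardyBoundaryCoulombGasBoundaryDefectGaussianRStubTransferPart1
import Summits.CriticalPhenomena.CardyFormulaZ2.Theorems.CardyBoundaryCoulombGasBoundaryDefectGaussianRStubTransferPart5
import Literature.Probability.LatticeModels.CollarLegModel
import Literature.Probability.LatticeModels.DirichletGreenFunction

/-!
# Stub `stub_transfer` of line `rainbow-monomials-in-excursion-kernels` — crux `BoundaryDefectGaussianR` (stmt-CriticalPhenomena-14132)

The registered stub (signature verbatim from the skeleton
`Cruxes/BoundaryDefectGaussianR/Lines/rainbow-monomials-in-excursion-kernels.lean`): RIGIDITY →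
REFERENCE LIMIT → GREEN KERNEL ASYMPTOTICS → the crux `BoundaryDefectGaussianR` by name.
Proof: the flat-mark geometry `s6_flatMarkGeometry` (Parts 3–5: `w` real on the boundary, one
half-ball inside, `w′ ≠ 0` at the marks, injectivity of `w` on the marks, and the orientation
lemma "increasing `Re w` along the boundary ⇒ interior on the left") supplies the hypotheses that
RIGIDITY and the GREEN asymptotics consume; then the limit algebra of Part 1: reference data
shifted to where it is admissible, `F_n → ℓ` by rigidity + reference limit, the Green asymptotics
for every pair of marks (admissible points have exactly one outside neighbour), `transfer_limit`
(the mesh powers cancel by `2Σ_{i<i'}(−e_ie_i'/6) = Σ_i h(e_i)`) and `transfer_limit_value` (Kac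
weights from pairs); the constant is `C = e^ℓ c^{Σ_{i<i'}(−e_ie_i'/6)}`.
-/

noncomputable section

open Filter Topology
open Literature.Probability.LatticeModels Literature.Probability.RandomPlanarGeometry

namespace Summit.CriticalPhenomena.CardyFormulaZ2.Cruxes.BoundaryDefectGaussianR.RainbowMonomialsInExcursionKernels

/-- **Registered sub-goal `s6_boundaryVertices` (Stub 6).** Admissible rainbow insertion data puts
every insertion point — the sink `p j` and the sources `p i`, `i ≠ j` — at a vertex of `V` with
exactly one lattice neighbour outside `V` (the fourth clause of `IsAdmissible`): the flatness of
admissible points that feeds the Green-kernel asymptotics for every pair of marks. [folklore] -/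
theorem s6_boundaryVertices :
    ∀ (k : ℕ) (L : Fin k → ℕ) (j : Fin k) (V : Finset (ℤ × ℤ)) (p : Fin k → ℤ × ℤ),
    Literature.Probability.LatticeModels.CollarLegModel.LegInsertionData.IsAdmissible
    (⟨(Finset.univ.erase j).image p, fun v ↦ ∑ b ∈ (Finset.univ.erase j).filter (fun b ↦ p b = v), L b,
    p j⟩ : Literature.Probability.LatticeModels.CollarLegModel.LegInsertionData) V → ∀ i : Fin k,
    p i ∈ V ∧ ((Literature.Probability.LatticeModels.CollarLegModel.neighbours (p i)).filter
    (fun u ↦ u ∉ V)).card = 1 := by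
  intro k L j V p hadm i
  obtain ⟨-, -, -, h4, -, -⟩ := hadm
  have hmem : p i ∈ insert (p j) ((Finset.univ.erase j).image p) := by
    by_cases hij : i = j
    · subst hij
      exact Finset.mem_insert_self _ _
    · exact Finset.mem_insert_of_mem
        (Finset.mem_image_of_mem _ (Finset.mem_erase.2 ⟨hij, Finset.mem_univ _⟩))
  obtain ⟨hm, hcard, -⟩ := h4 (p i) hmem
  exact ⟨hm, hcard⟩

/-- **Stub 6 — transfer (limit algebra).** RIGIDITY → REFERENCE LIMIT → GREEN KERNEL ASYMPTOTICS →
the crux `BoundaryDefectGaussianR` BY NAME. Content: (i) orientation lemma — the crux's hypothesis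
"`re ∘ w ∘ D.boundary` strictly increasing near each mark" for a holomorphic bijection `D → ℍ` gives
"interior on the left" at the sink mark (local biholomorphy at a flat boundary point via Schwarz
reflection / identity theorem); (ii) flatness of admissible points (one outside neighbour) feeds Stub
5 for every pair; (iii) with `F_n → ℓ` (Stubs 3+4 along the crux's mesh sequence, reference data
shifted to start where admissible): `log(δ_n^{-Σh} P_n) = Σ_{i<i'}(−e_ie_i'/6) log(G/δ_n²) + F_n`
EXACTLY, because `2Σ_{i<i'}(−e_ie_i'/6) = Σ_i h(e_i)` at `Σe = 1` (`mesh_powers_cancel`); pass to the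
limit, exponentiate, and rewrite `∏ K^{−e_ie_i'/6} = ∏|w_i − w_i'|^{e_ie_i'/3} ∏|w′_i|^{h(e_i)}` by
`kac_from_pairs`; the constant is `C = e^ℓ · c^{Σ_{i<i'}(−e_ie_i'/6)}`, a function of `(k, L, j)`
only. Size: M–L (M for the algebra, L for (i) in Lean). [folklore] -/
theorem stub_transfer :
    (∀ (k : ℕ) (L : Fin k → ℕ) (j : Fin k), L j = ∑ i ∈ Finset.univ.erase j, L i → ∀ (D D' :
    Literature.Probability.RandomPlanarGeometry.MarkedDomain k), (∃ S : Finset (ℂ × ℂ), (∀ q ∈ S, q.1.re =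
    q.2.re ∨ q.1.im = q.2.im) ∧ frontier D.carrier ⊆ ⋃ q ∈ S, segment ℝ q.1 q.2) → (∀ i, (∃ r : ℝ, 0 < r ∧ ((∀ z
    ∈ frontier D.carrier, dist z (D.pt i) < r → z.im = (D.pt i).im) ∨ (∀ z ∈ frontier D.carrier, dist z (D.pt i)
    < r → z.re = (D.pt i).re)))) → (∃ τ : ℂ, ‖τ‖ = 1 ∧ (∃ ε : ℝ, 0 < ε ∧ ∀ t ∈ Set.Ioo (D.mark j) (D.mark j +
    ε), ∃ s : ℝ, 0 < s ∧ D.boundary t = D.pt j + (s : ℂ) * τ) ∧ (∃ ε : ℝ, 0 < ε ∧ ∀ s ∈ Set.Ioo (0 : ℝ) ε, D.pt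
    j + (s : ℂ) * (τ * Complex.I) ∈ D.carrier)) → (∃ S : Finset (ℂ × ℂ), (∀ q ∈ S, q.1.re = q.2.re ∨ q.1.im =
    q.2.im) ∧ frontier D'.carrier ⊆ ⋃ q ∈ S, segment ℝ q.1 q.2) → (∀ i, (∃ r : ℝ, 0 < r ∧ ((∀ z ∈ frontier
    D'.carrier, dist z (D'.pt i) < r → z.im = (D'.pt i).im) ∨ (∀ z ∈ frontier D'.carrier, dist z (D'.pt i) < r →
    z.re = (D'.pt i).re)))) → (∃ τ : ℂ, ‖τ‖ = 1 ∧ (∃ ε : ℝ, 0 < ε ∧ ∀ t ∈ Set.Ioo (D'.mark j) (D'.mark j + ε), ∃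
    s : ℝ, 0 < s ∧ D'.boundary t = D'.pt j + (s : ℂ) * τ) ∧ (∃ ε : ℝ, 0 < ε ∧ ∀ s ∈ Set.Ioo (0 : ℝ) ε, D'.pt j +
    (s : ℂ) * (τ * Complex.I) ∈ D'.carrier)) → ∀ (δ : ℕ → ℝ), (∀ n, 0 < δ n) → Filter.Tendsto δ Filter.atTop
    (nhds 0) → ∀ (V V' : ℕ → Finset (ℤ × ℤ)), (∀ n, ∀ v : ℤ × ℤ, v ∈ V n ↔ (((v).1 : ℂ) * ((δ n : ℝ) : ℂ) +
    ((v).2 : ℂ) * ((δ n : ℝ) : ℂ) * Complex.I) ∈ closure D.carrier) → (∀ n, ∀ v : ℤ × ℤ, v ∈ V' n ↔ (((v).1 : ℂ)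
    * ((δ n : ℝ) : ℂ) + ((v).2 : ℂ) * ((δ n : ℝ) : ℂ) * Complex.I) ∈ closure D'.carrier) → ∀ (p p' : ℕ → Fin k →
    ℤ × ℤ), (∀ n, Function.Injective ((p) n)) → (∀ n, Function.Injective ((p') n)) → (∀ i, Filter.Tendsto (fun n
    ↦ ((((p) n i).1 : ℂ) * ((δ n : ℝ) : ℂ) + (((p) n i).2 : ℂ) * ((δ n : ℝ) : ℂ) * Complex.I)) Filter.atTop
    (nhds (D.pt i))) → (∀ i, Filter.Tendsto (fun n ↦ ((((p') n i).1 : ℂ) * ((δ n : ℝ) : ℂ) + (((p') n i).2 : ℂ)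
    * ((δ n : ℝ) : ℂ) * Complex.I)) Filter.atTop (nhds (D'.pt i))) → (∀ n,
    Literature.Probability.LatticeModels.CollarLegModel.LegInsertionData.IsAdmissible (⟨(Finset.univ.erase
    j).image ((p) n), fun v ↦ ∑ b ∈ (Finset.univ.erase j).filter (fun b ↦ ((p) n) b = v), L b, ((p) n) j⟩ :
    Literature.Probability.LatticeModels.CollarLegModel.LegInsertionData) (V n)) → (∀ n,
    Literature.Probability.LatticeModels.CollarLegModel.LegInsertionData.IsAdmissible (⟨(Finset.univ.erase
    j).image ((p') n), fun v ↦ ∑ b ∈ (Finset.univ.erase j).filter (fun b ↦ ((p') n) b = v), L b, ((p') n) j⟩ :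
    Literature.Probability.LatticeModels.CollarLegModel.LegInsertionData) (V' n)) → (∀ᶠ n in Filter.atTop, 0 <
    (‖Literature.Probability.LatticeModels.CollarLegModel.Zins (V n) (⟨(Finset.univ.erase j).image (p n), fun v
    ↦ ∑ b ∈ (Finset.univ.erase j).filter (fun b ↦ (p n) b = v), L b, (p n) j⟩ :
    Literature.Probability.LatticeModels.CollarLegModel.LegInsertionData)‖ /
    ‖(Literature.Probability.LatticeModels.CollarLegModel.ofDomain (V n)).Z‖)) ∧ Filter.Tendsto (fun n ↦
    (Real.log (‖Literature.Probability.LatticeModels.CollarLegModel.Zins (V n) (⟨(Finset.univ.erase j).image (p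
    n), fun v ↦ ∑ b ∈ (Finset.univ.erase j).filter (fun b ↦ (p n) b = v), L b, (p n) j⟩ :
    Literature.Probability.LatticeModels.CollarLegModel.LegInsertionData)‖ /
    ‖(Literature.Probability.LatticeModels.CollarLegModel.ofDomain (V n)).Z‖) - (∑ i₁ : Fin k, ∑ i₂ ∈
    Finset.univ.filter (fun i₂ : Fin k ↦ i₁ < i₂), (-((if i₁ = j then (1 - (L j : ℝ)) else (L i₁ : ℝ)) * (if i₂
    = j then (1 - (L j : ℝ)) else (L i₂ : ℝ))) / 6) * Real.log
    (Literature.Probability.LatticeModels.dirichletGreen ((V n).image (fun v : ℤ × ℤ ↦ (![v.1, v.2] : Fin 2 →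
    ℤ))) (![((p n) i₁).1, ((p n) i₁).2] : Fin 2 → ℤ) (![((p n) i₂).1, ((p n) i₂).2] : Fin 2 → ℤ)))) - (Real.log
    (‖Literature.Probability.LatticeModels.CollarLegModel.Zins (V' n) (⟨(Finset.univ.erase j).image (p' n), fun
    v ↦ ∑ b ∈ (Finset.univ.erase j).filter (fun b ↦ (p' n) b = v), L b, (p' n) j⟩ :
    Literature.Probability.LatticeModels.CollarLegModel.LegInsertionData)‖ /
    ‖(Literature.Probability.LatticeModels.CollarLegModel.ofDomain (V' n)).Z‖) - (∑ i₁ : Fin k, ∑ i₂ ∈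
    Finset.univ.filter (fun i₂ : Fin k ↦ i₁ < i₂), (-((if i₁ = j then (1 - (L j : ℝ)) else (L i₁ : ℝ)) * (if i₂
    = j then (1 - (L j : ℝ)) else (L i₂ : ℝ))) / 6) * Real.log
    (Literature.Probability.LatticeModels.dirichletGreen ((V' n).image (fun v : ℤ × ℤ ↦ (![v.1, v.2] : Fin 2 →
    ℤ))) (![((p' n) i₁).1, ((p' n) i₁).2] : Fin 2 → ℤ) (![((p' n) i₂).1, ((p' n) i₂).2] : Fin 2 → ℤ)))))
    Filter.atTop (nhds 0)) → (∀ (k : ℕ) (L : Fin k → ℕ) (j : Fin k), L j = ∑ i ∈ Finset.univ.erase j, L i → ∃ D₀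
    : Literature.Probability.RandomPlanarGeometry.MarkedDomain k, (∃ S : Finset (ℂ × ℂ), (∀ q ∈ S, q.1.re =
    q.2.re ∨ q.1.im = q.2.im) ∧ frontier D₀.carrier ⊆ ⋃ q ∈ S, segment ℝ q.1 q.2) ∧ (∀ i, (∃ r : ℝ, 0 < r ∧ ((∀
    z ∈ frontier D₀.carrier, dist z (D₀.pt i) < r → z.im = (D₀.pt i).im) ∨ (∀ z ∈ frontier D₀.carrier, dist z
    (D₀.pt i) < r → z.re = (D₀.pt i).re)))) ∧ (∃ τ : ℂ, ‖τ‖ = 1 ∧ (∃ ε : ℝ, 0 < ε ∧ ∀ t ∈ Set.Ioo (D₀.mark j)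
    (D₀.mark j + ε), ∃ s : ℝ, 0 < s ∧ D₀.boundary t = D₀.pt j + (s : ℂ) * τ) ∧ (∃ ε : ℝ, 0 < ε ∧ ∀ s ∈ Set.Ioo
    (0 : ℝ) ε, D₀.pt j + (s : ℂ) * (τ * Complex.I) ∈ D₀.carrier)) ∧ (∀ (δ : ℕ → ℝ), (∀ n, 0 < δ n) →
    Filter.Tendsto δ Filter.atTop (nhds 0) → ∀ (V : ℕ → Finset (ℤ × ℤ)), (∀ n, ∀ v : ℤ × ℤ, v ∈ V n ↔ (((v).1 :
    ℂ) * ((δ n : ℝ) : ℂ) + ((v).2 : ℂ) * ((δ n : ℝ) : ℂ) * Complex.I) ∈ closure D₀.carrier) → ∃ p : ℕ → Fin k →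
    ℤ × ℤ, (∀ n, Function.Injective ((p) n)) ∧ (∀ i, Filter.Tendsto (fun n ↦ ((((p) n i).1 : ℂ) * ((δ n : ℝ) :
    ℂ) + (((p) n i).2 : ℂ) * ((δ n : ℝ) : ℂ) * Complex.I)) Filter.atTop (nhds (D₀.pt i))) ∧ ∃ N : ℕ, ∀ n, N ≤ n
    → Literature.Probability.LatticeModels.CollarLegModel.LegInsertionData.IsAdmissible (⟨(Finset.univ.erase
    j).image (p n), fun v ↦ ∑ b ∈ (Finset.univ.erase j).filter (fun b ↦ (p n) b = v), L b, (p n) j⟩ :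
    Literature.Probability.LatticeModels.CollarLegModel.LegInsertionData) (V n)) ∧ ∃ ℓ : ℝ, ∀ (δ : ℕ → ℝ), (∀ n,
    0 < δ n) → Filter.Tendsto δ Filter.atTop (nhds 0) → ∀ (V : ℕ → Finset (ℤ × ℤ)), (∀ n, ∀ v : ℤ × ℤ, v ∈ V n ↔
    (((v).1 : ℂ) * ((δ n : ℝ) : ℂ) + ((v).2 : ℂ) * ((δ n : ℝ) : ℂ) * Complex.I) ∈ closure D₀.carrier) → ∀ (p : ℕ
    → Fin k → ℤ × ℤ), (∀ n, Function.Injective ((p) n)) → (∀ i, Filter.Tendsto (fun n ↦ ((((p) n i).1 : ℂ) * ((δ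
    n : ℝ) : ℂ) + (((p) n i).2 : ℂ) * ((δ n : ℝ) : ℂ) * Complex.I)) Filter.atTop (nhds (D₀.pt i))) → (∀ n,
    Literature.Probability.LatticeModels.CollarLegModel.LegInsertionData.IsAdmissible (⟨(Finset.univ.erase
    j).image ((p) n), fun v ↦ ∑ b ∈ (Finset.univ.erase j).filter (fun b ↦ ((p) n) b = v), L b, ((p) n) j⟩ :
    Literature.Probability.LatticeModels.CollarLegModel.LegInsertionData) (V n)) → Filter.Tendsto (fun n ↦
    (Real.log (‖Literature.Probability.LatticeModels.CollarLegModel.Zins (V n) (⟨(Finset.univ.erase j).image (p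
    n), fun v ↦ ∑ b ∈ (Finset.univ.erase j).filter (fun b ↦ (p n) b = v), L b, (p n) j⟩ :
    Literature.Probability.LatticeModels.CollarLegModel.LegInsertionData)‖ /
    ‖(Literature.Probability.LatticeModels.CollarLegModel.ofDomain (V n)).Z‖) - (∑ i₁ : Fin k, ∑ i₂ ∈
    Finset.univ.filter (fun i₂ : Fin k ↦ i₁ < i₂), (-((if i₁ = j then (1 - (L j : ℝ)) else (L i₁ : ℝ)) * (if i₂
    = j then (1 - (L j : ℝ)) else (L i₂ : ℝ))) / 6) * Real.log
    (Literature.Probability.LatticeModels.dirichletGreen ((V n).image (fun v : ℤ × ℤ ↦ (![v.1, v.2] : Fin 2 →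
    ℤ))) (![((p n) i₁).1, ((p n) i₁).2] : Fin 2 → ℤ) (![((p n) i₂).1, ((p n) i₂).2] : Fin 2 → ℤ)))))
    Filter.atTop (nhds ℓ)) → (∃ c : ℝ, 0 < c ∧ ∀ (D : Literature.Probability.RandomPlanarGeometry.JordanDomain),
    (∃ S : Finset (ℂ × ℂ), (∀ q ∈ S, q.1.re = q.2.re ∨ q.1.im = q.2.im) ∧ frontier D.carrier ⊆ ⋃ q ∈ S, segment
    ℝ q.1 q.2) → ∀ (x y : ℂ), x ∈ frontier D.carrier → y ∈ frontier D.carrier → x ≠ y → (∃ r : ℝ, 0 < r ∧ ((∀ z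
    ∈ frontier D.carrier, dist z (x) < r → z.im = (x).im) ∨ (∀ z ∈ frontier D.carrier, dist z (x) < r → z.re =
    (x).re))) → (∃ r : ℝ, 0 < r ∧ ((∀ z ∈ frontier D.carrier, dist z (y) < r → z.im = (y).im) ∨ (∀ z ∈ frontier
    D.carrier, dist z (y) < r → z.re = (y).re))) → ∀ (w : ℂ → ℂ) (U : Set ℂ), IsOpen U → D.carrier ⊆ U → x ∈ U →
    y ∈ U → DifferentiableOn ℂ w U → Set.BijOn w D.carrier {z : ℂ | 0 < z.im} → ∀ (δ : ℕ → ℝ), (∀ n, 0 < δ n) →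
    Filter.Tendsto δ Filter.atTop (nhds 0) → ∀ (V : ℕ → Finset (ℤ × ℤ)), (∀ n, ∀ v : ℤ × ℤ, v ∈ V n ↔ (((v).1 :
    ℂ) * ((δ n : ℝ) : ℂ) + ((v).2 : ℂ) * ((δ n : ℝ) : ℂ) * Complex.I) ∈ closure D.carrier) → ∀ (a b : ℕ → ℤ ×
    ℤ), (∀ n, a n ∈ V n ∧ ((Literature.Probability.LatticeModels.CollarLegModel.neighbours (a n)).filter (fun u
    ↦ u ∉ V n)).card = 1) → (∀ n, b n ∈ V n ∧ ((Literature.Probability.LatticeModels.CollarLegModel.neighbours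
    (b n)).filter (fun u ↦ u ∉ V n)).card = 1) → Filter.Tendsto (fun n ↦ (((a n).1 : ℂ) * ((δ n : ℝ) : ℂ) + ((a
    n).2 : ℂ) * ((δ n : ℝ) : ℂ) * Complex.I)) Filter.atTop (nhds x) → Filter.Tendsto (fun n ↦ (((b n).1 : ℂ) *
    ((δ n : ℝ) : ℂ) + ((b n).2 : ℂ) * ((δ n : ℝ) : ℂ) * Complex.I)) Filter.atTop (nhds y) → Filter.Tendsto (fun
    n ↦ (Literature.Probability.LatticeModels.dirichletGreen ((V n).image (fun v : ℤ × ℤ ↦ (![v.1, v.2] : Fin 2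
    → ℤ))) (![(a n).1, (a n).2] : Fin 2 → ℤ) (![(b n).1, (b n).2] : Fin 2 → ℤ)) / (δ n) ^ 2) Filter.atTop (nhds
    (c * (‖deriv w x‖ * ‖deriv w y‖ / ‖w x - w y‖ ^ 2)))) →
    Summit.CriticalPhenomena.CardyFormulaZ2.Theses.CardyBoundaryCoulombGas.BoundaryDefectGaussianR := by
  intro hRig hRef hGreen k L j hL
  obtain ⟨D₀, hrect₀, hflat₀, hor₀, happ₀, ℓ, hlim₀⟩ := hRef k L j hL
  obtain ⟨c, hc, hG⟩ := hGreen
  have hsum1 := transfer_sum_labels L j hL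
  refine ⟨Real.exp ℓ * c ^ (∑ i : Fin k, ∑ i' ∈ Finset.univ.filter (fun i' : Fin k ↦ i < i'),
    (-((if i = j then (1 - (L j : ℝ)) else (L i : ℝ)) * (if i' = j then (1 - (L j : ℝ)) else (L i' : ℝ)))
      / 6)), by positivity, ?_⟩
  intro D hrect hflat w U hU hsub hpt hw hbij hmono δ hδ hδ0 V hV p hpinj hplim hadm
  obtain ⟨hor, hderiv, hwinj⟩ := s6_flatMarkGeometry k D hflat w U hU hsub hpt hw hbij hmono
  -- boundary-vertex facts for the insertion points, from admissibility
  have hbv : ∀ i n, p n i ∈ V n ∧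
      ((CollarLegModel.neighbours (p n i)).filter (fun u ↦ u ∉ V n)).card = 1 :=
    fun i n ↦ s6_boundaryVertices k L j (V n) (p n) (hadm n) i
  -- the reference lattice domains
  have hfin : ∀ n, {v : ℤ × ℤ | ((v.1 : ℂ) * ((δ n : ℝ) : ℂ) + (v.2 : ℂ) * ((δ n : ℝ) : ℂ) *
      Complex.I) ∈ closure D₀.carrier}.Finite :=
    fun n ↦ transfer_lattice_finite _ D₀.isBounded.closure _ (hδ n)
  obtain ⟨V₀, hV₀⟩ : ∃ V₀ : ℕ → Finset (ℤ × ℤ), ∀ n, ∀ v : ℤ × ℤ, v ∈ V₀ n ↔ (((v).1 : ℂ) *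
      ((δ n : ℝ) : ℂ) + ((v).2 : ℂ) * ((δ n : ℝ) : ℂ) * Complex.I) ∈ closure D₀.carrier :=
    ⟨fun n ↦ (hfin n).toFinset, fun n v ↦ by rw [Set.Finite.mem_toFinset]; rfl⟩
  obtain ⟨p₀, hp₀inj, hp₀lim, N, hp₀adm⟩ := happ₀ δ hδ hδ0 V₀ hV₀
  -- rigidity and the reference limit along the shifted sequences
  have hδ' : ∀ n, 0 < δ (n + N) := fun n ↦ hδ _
  have hδ0' : Filter.Tendsto (fun n ↦ δ (n + N)) Filter.atTop (nhds 0) :=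
    hδ0.comp (tendsto_add_atTop_nat N)
  obtain ⟨hpos', hdiff'⟩ := hRig k L j hL D D₀ hrect hflat (hor j) hrect₀ hflat₀ hor₀
    (fun n ↦ δ (n + N)) hδ' hδ0' (fun n ↦ V (n + N)) (fun n ↦ V₀ (n + N)) (fun n ↦ hV (n + N))
    (fun n ↦ hV₀ (n + N)) (fun n ↦ p (n + N)) (fun n ↦ p₀ (n + N)) (fun n ↦ hpinj (n + N))
    (fun n ↦ hp₀inj (n + N)) (fun i ↦ (hplim i).comp (tendsto_add_atTop_nat N))
    (fun i ↦ (hp₀lim i).comp (tendsto_add_atTop_nat N)) (fun n ↦ hadm (n + N))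
    (fun n ↦ hp₀adm (n + N) (Nat.le_add_left N n))
  have hlim' := hlim₀ (fun n ↦ δ (n + N)) hδ' hδ0' (fun n ↦ V₀ (n + N)) (fun n ↦ hV₀ (n + N))
    (fun n ↦ p₀ (n + N)) (fun n ↦ hp₀inj (n + N))
    (fun i ↦ (hp₀lim i).comp (tendsto_add_atTop_nat N))
    (fun n ↦ hp₀adm (n + N) (Nat.le_add_left N n))
  -- the limit value in the crux's shape
  have hval := transfer_limit_value (fun i ↦ if i = j then (1 - (L j : ℝ)) else (L i : ℝ)) hsum1 c ℓ
    hc (fun i ↦ w (D.pt i)) (fun i ↦ deriv w (D.pt i)) hwinj hderiv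
  beta_reduce at hval
  rw [← hval]
  refine transfer_limit
    (fun n ↦ ‖Literature.Probability.LatticeModels.CollarLegModel.Zins (V n) ⟨(Finset.univ.erase
      j).image (p n), fun v ↦ ∑ i ∈ (Finset.univ.erase j).filter (fun i ↦ p n i = v), L i, p n j⟩‖)
    (fun n ↦ ‖(Literature.Probability.LatticeModels.CollarLegModel.ofDomain (V n)).Z‖) δ
    (fun n i₁ i₂ ↦ Literature.Probability.LatticeModels.dirichletGreen ((V n).image (fun v : ℤ × ℤ ↦
      (![v.1, v.2] : Fin 2 → ℤ))) (![((p n) i₁).1, ((p n) i₁).2] : Fin 2 → ℤ)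
      (![((p n) i₂).1, ((p n) i₂).2] : Fin 2 → ℤ))
    (fun i₁ i₂ ↦ (-((if i₁ = j then (1 - (L j : ℝ)) else (L i₁ : ℝ)) *
      (if i₂ = j then (1 - (L j : ℝ)) else (L i₂ : ℝ))) / 6))
    (fun i i' ↦ ‖deriv w (D.pt i)‖ * ‖deriv w (D.pt i')‖ / ‖w (D.pt i) - w (D.pt i')‖ ^ 2)
    (∑ i : Fin k, (if i = j then (1 - (L j : ℝ)) else (L i : ℝ)) *
      ((if i = j then (1 - (L j : ℝ)) else (L i : ℝ)) - 1) / 6) c ℓ hδ hc ?_ ?_ ?_ ?_ ?_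
  · -- hK
    intro i i' hii'
    exact div_pos (mul_pos (norm_pos_iff.mpr (hderiv i)) (norm_pos_iff.mpr (hderiv i')))
      (pow_pos (norm_pos_iff.mpr (sub_ne_zero.mpr (hwinj i i' hii'.ne))) 2)
  · -- hH
    exact transfer_mesh (fun i ↦ if i = j then (1 - (L j : ℝ)) else (L i : ℝ)) hsum1
  · -- hP
    exact transfer_eventually_of_shift N hpos'
  · -- hF
    rw [← zero_add ℓ]
    refine (Filter.tendsto_add_atTop_iff_nat N).mp ?_
    exact Filter.Tendsto.congr (fun n ↦ sub_add_cancel _ _) (hdiff'.add hlim')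
  · -- hG
    intro i i' hii'
    exact hG D.toJordanDomain hrect (D.pt i) (D.pt i') (D.pt_mem_frontier i) (D.pt_mem_frontier i')
      (fun h ↦ hii'.ne (D.pt_injective h)) (hflat i) (hflat i') w U hU hsub (hpt i) (hpt i') hw hbij
      δ hδ hδ0 V hV (fun n ↦ p n i) (fun n ↦ p n i') (hbv i) (hbv i') (hplim i) (hplim i')

end Summit.CriticalPhenomena.CardyFormulaZ2.Cruxes.BoundaryDefectGaussianR.RainbowMonomialsInExcursionKernels

end
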